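import Literature.IUT.LogThetaLattice.TensorPacketsHermitian
import Literature.IUT.LogThetaLattice.TensorPacketsProofs
import HarnessLib

/-!
# [IUTchIII] Proposition 3.2: the sub-packet `log(^{A,α}𝒟^⊢_v) ⊆ log(^A𝒟^⊢_{v_ℚ})` and its integral structures

S. Mochizuki, *Inter-universal Teichmüller theory III*, kurims manuscript (May 2020), §3, Proposition
3.2 "(Local Mono-analytic Tensor Packets)", pp. 97–99 (PRIMS **57** (2021), offset ≈ +420), node
**IUTchIII:Prop3.2(ii)** (with the notational preamble of Prop. 3.2, p. 98, and Prop. 3.1 (ii), p. 93).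
Record-only typing under the claim key `Mochizuki2012` (D-0012, disputed); the content of THIS file is
undisputed finite-dimensional multilinear algebra. Nothing here takes a side on [IUTchIII] Cor. 3.12;
typed ≠ discharged.

PRINT (p. 98): "For `α ∈ A`, `v ∈ 𝕍`, `v_ℚ ∈ 𝕍_ℚ` such that `v | v_ℚ`, we shall write
`log(^{A,α}𝒟^⊢_v) ⊆ log(^A𝒟^⊢_{v_ℚ})` for the ind-topological submodule determined by the tensor product
of the factors labeled by `β ∈ A∖{α}` with the tensor product of the direct summand with subscript `v`
of the factor labeled `α`"; (ii): the log-shells "determine [i.e., by forming suitable direct sums and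
tensor products] topological submodules `𝓘(^α𝒟^⊢_{v_ℚ}) ⊆ log(^α𝒟^⊢_{v_ℚ})`; `𝓘(^A𝒟^⊢_{v_ℚ}) ⊆ log(^A𝒟^⊢_{v_ℚ})`;
`𝓘(^{A,α}𝒟^⊢_v) ⊆ log(^{A,α}𝒟^⊢_v)`", and at archimedean `v_ℚ` the three closed unit balls of the induced
Hermitian metrics.

TYPED STATE BEFORE THIS FILE. `TensorPackets.lean` (abc-iut-L6-t4, p403825) types `log(^{A,α}𝒟^⊢_v)` as the
ABSTRACT binary tensor product `MPacketAt 𝕜 D α v = D α v ⊗ (⊗_{β≠α} ⊕_w D β w)`; the printed "`⊆`" — that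
this module IS a submodule of the `n`-tensor packet `MPacketN 𝕜 D = ⊗_{γ∈A} ⊕_w D γ w` — is not a decl,
and consequently neither is the relation between the third integral structure (`shellPacketAt`,
resp. the Hermitian `hermitianBallAt` of `TensorPacketsHermitian.lean`, abc-iut-w4-d039, p412100) and
the second (`shellPacketN`, resp. `hermitianBallN`). The Cor. 3.12 sub-crew's containers
(`Summits/ABC/IUTFork/Thm311Real2.lean`, binders `archSub j v : Set (Packet j (over v))`) expect the
`(A,α)`-integral structures INSIDE the ambient `v_ℚ`-packet.

WHAT THIS FILE SUPPLIES (all PROVED):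
* `MPacketAt.incl : log(^{A,α}𝒟^⊢_v) →ₗ log(^A𝒟^⊢_{v_ℚ})`, the canonical map
  `x ⊗ (⊗_{β≠α} y_β) ↦ ⊗_γ m_γ` with `m_α = (0,…,x,…,0)` (the summand with subscript `v`) and `m_β = y_β`
  (`incl_tmul_tprod`), together with a retraction `MPacketAt.retr` (`retr_incl`), hence INJECTIVE
  (`incl_injective`): the printed "`⊆`".
* nonarchimedean `v_ℚ`: the image of `𝓘(^{A,α}𝒟^⊢_v)` lies in `𝓘(^A𝒟^⊢_{v_ℚ})` (`map_incl_shellPacketAt_le`),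
  and conversely the third integral structure is EXACTLY the trace of the second:
  `𝓘(^{A,α}𝒟^⊢_v) = log(^{A,α}𝒟^⊢_v) ∩ 𝓘(^A𝒟^⊢_{v_ℚ})` (`comap_incl_shellPacketN`) — for ARBITRARY additive
  subgroups `𝓘_{^γ𝒟^⊢_w}` (the generators `⊗_γ m_γ` of `𝓘(^A𝒟^⊢_{v_ℚ})` split along `m_α = (m_α)_v + (m_α − (m_α)_v)`
  into a generator in the image of `𝓘(^{A,α}𝒟^⊢_v)` plus one killed by the retraction).
* archimedean `v_ℚ`: the tensor product Hermitian metric of `log(^{A,α}𝒟^⊢_v)` IS the restriction of the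
  tensor product Hermitian metric of `log(^A𝒟^⊢_{v_ℚ})` (`atForm_eq_tensorForm_incl`), so the third unit
  ball is EXACTLY the trace of the second: `𝓘(^{A,α}𝒟^⊢_v) = log(^{A,α}𝒟^⊢_v) ∩ 𝓘(^A𝒟^⊢_{v_ℚ})`
  (`hermitianBallAt_eq_preimage_hermitianBallN`, `image_incl_hermitianBallAt`).
Deliberately NOT here: ind-topologies; the holomorphic (ring-theoretic) packets of Prop. 3.1 (ii) (their
"direct summand" reading is `Prop31ii_directSummand'`, PROVED in `TensorPacketsProofs.lean`).
-/

noncomputable section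

namespace Literature.IUT.LogThetaLattice

open scoped TensorProduct
open PiTensorProduct Function

universe u v v' w

/-! ### The inclusion `log(^{A,α}𝒟^⊢_v) ⊆ log(^A𝒟^⊢_{v_ℚ})` -/

section Inclusion

variable (𝕜 : Type u) [Field 𝕜]
variable {A : Type v} [DecidableEq A]
variable {Vfib : Type v'} [DecidableEq Vfib]
variable (D : A → Vfib → Type w) [∀ α v, AddCommGroup (D α v)] [∀ α v, Module 𝕜 (D α v)]

variable {D} in
/-- Reassembling a family indexed by `A` from its `α`-component `m` and its components `y_β`, `β ≠ α`:
the family `γ ↦ m` (if `γ = α`), `γ ↦ y_γ` (if `γ ≠ α`) — the index bookkeeping behind "the tensor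
product of the factors labeled by `β ∈ A∖{α}` with … the factor labeled `α`" ([IUTchIII] Prop. 3.2,
p. 98). [claim: Mochizuki2012, status: disputed] -/
def MPacket1.insertAt (α : A) (m : MPacket1 D α) (y : ∀ β : {β : A // β ≠ α}, MPacket1 D β.1) :
    ∀ γ : A, MPacket1 D γ :=
  update (fun γ => if h : γ ≠ α then y ⟨γ, h⟩ else 0) α m

variable {D} in
omit [DecidableEq Vfib] in
/-- The `α`-component of the reassembled family is `m`. [claim: Mochizuki2012, status: disputed] -/
@[simp] theorem MPacket1.insertAt_self (α : A) (m : MPacket1 D α)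
    (y : ∀ β : {β : A // β ≠ α}, MPacket1 D β.1) : MPacket1.insertAt α m y α = m :=
  update_self _ _ _

variable {D} in
omit [DecidableEq Vfib] in
/-- The `γ`-component, `γ ≠ α`, of the reassembled family is `y_γ`. [claim: Mochizuki2012, status: disputed] -/
theorem MPacket1.insertAt_of_ne (α : A) (m : MPacket1 D α)
    (y : ∀ β : {β : A // β ≠ α}, MPacket1 D β.1) {γ : A} (h : γ ≠ α) :
    MPacket1.insertAt α m y γ = y ⟨γ, h⟩ := by
  rw [MPacket1.insertAt, update_of_ne h]
  exact dif_pos h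

variable {D} in
omit [DecidableEq Vfib] in
/-- The `β`-component (`β : {β // β ≠ α}`) of the reassembled family is `y_β`.
[claim: Mochizuki2012, status: disputed] -/
@[simp] theorem MPacket1.insertAt_coe (α : A) (m : MPacket1 D α)
    (y : ∀ β : {β : A // β ≠ α}, MPacket1 D β.1) (β : {β : A // β ≠ α}) :
    MPacket1.insertAt α m y β.1 = y β :=
  MPacket1.insertAt_of_ne α m y β.2

/-- The index `α` as the (unique) element of the complementary subtype `{a // ¬ a ≠ α}`. [folklore] -/
abbrev MPacketAt.idxSelf (α : A) : {a : A // ¬ a ≠ α} := ⟨α, fun h => h rfl⟩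

/-- **[IUTchIII] Prop. 3.2, p. 98: `log(^{A,α}𝒟^⊢_v) ⊆ log(^A𝒟^⊢_{v_ℚ})`** — the canonical linear map from the
`(A,α)`-packet at `v` (typed as the abstract tensor product `log(^α𝒟^⊢_v) ⊗ (⊗_{β≠α} log(^β𝒟^⊢_{v_ℚ}))`,
`MPacketAt`) into the `n`-tensor packet `⊗_{γ∈A} log(^γ𝒟^⊢_{v_ℚ})`: "the tensor product of the factors
labeled by `β ∈ A∖{α}` with … the direct summand with subscript `v` of the factor labeled `α`", i.e.
`x ⊗ (⊗_β y_β) ↦ ⊗_γ m_γ` with `m_α =` the vector of `⊕_w log(^α𝒟^⊢_w)` supported at `w = v` with value `x`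
and `m_β = y_β` (`incl_tmul_tprod`). Built from Mathlib's `MultilinearMap.domDomRestrictₗ` (fixing the
`α`-argument of `⊗_γ`) and `LinearMap.single`. [claim: Mochizuki2012, status: disputed] -/
def MPacketAt.incl (α : A) (v : Vfib) : MPacketAt 𝕜 D α v →ₗ[𝕜] MPacketN 𝕜 D :=
  TensorProduct.lift
    (((PiTensorProduct.lift (R := 𝕜) (s := fun β : {β : A // β ≠ α} => MPacket1 D β.1)
            (E := MPacketN 𝕜 D)).toLinearMap ∘ₗ
        ((MultilinearMap.domDomRestrictₗ (PiTensorProduct.tprod 𝕜 (s := fun γ : A => MPacket1 D γ))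
            (fun a : A => a ≠ α)).toLinearMap (fun _ => 0) (MPacketAt.idxSelf α))) ∘ₗ
      LinearMap.single 𝕜 (fun w : Vfib => D α w) v)

/-- The inclusion on elementary tensors: `incl (x ⊗ (⊗_β y_β)) = ⊗_γ (insertAt α (0,…,x_v,…,0) y)_γ`.
[claim: Mochizuki2012, status: disputed] -/
@[simp] theorem MPacketAt.incl_tmul_tprod (α : A) (v : Vfib) (x : D α v)
    (y : ∀ β : {β : A // β ≠ α}, MPacket1 D β.1) :
    MPacketAt.incl 𝕜 D α v (x ⊗ₜ tprod 𝕜 y) = tprod 𝕜 (MPacket1.insertAt α (Pi.single v x) y) := by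
  unfold MPacketAt.incl
  rw [TensorProduct.lift.tmul, LinearMap.comp_apply, LinearMap.comp_apply, LinearMap.single_apply,
    MultilinearMap.toLinearMap_apply, LinearEquiv.coe_toLinearMap, PiTensorProduct.lift.tprod]
  change (MultilinearMap.domDomRestrict (PiTensorProduct.tprod 𝕜 (s := fun γ : A => MPacket1 D γ))
    (fun a : A => a ≠ α) _) y = _
  rw [MultilinearMap.domDomRestrict_apply]
  congr 1
  funext γ
  by_cases h : γ ≠ α
  · rw [dif_pos h, MPacket1.insertAt_of_ne α _ y h]
  · rw [dif_neg h]
    obtain rfl : γ = α := not_not.mp h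
    rw [MPacket1.insertAt_self]
    exact update_self _ _ _

/-- The retraction `log(^A𝒟^⊢_{v_ℚ}) → log(^{A,α}𝒟^⊢_v)` as a multilinear map in the factors:
`(m_γ)_γ ↦ (m_α)_v ⊗ (⊗_{β≠α} m_β)` (projection of the `α`-factor onto its summand with subscript `v`).
[claim: Mochizuki2012, status: disputed] -/
def MPacketAt.retrMultilinear (α : A) (v : Vfib) :
    MultilinearMap 𝕜 (fun γ : A => MPacket1 D γ) (MPacketAt 𝕜 D α v) where
  toFun m := m α v ⊗ₜ[𝕜] tprod 𝕜 (fun β : {β : A // β ≠ α} => m β.1)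
  map_update_add' m i a b := by
    by_cases h : i = α
    · subst h
      have hβ : ∀ c : MPacket1 D i,
          (fun β : {β : A // β ≠ i} => update m i c β.1) = fun β : {β : A // β ≠ i} => m β.1 :=
        fun c => funext fun β : {β : A // β ≠ i} => update_of_ne β.2 _ _
      rw [hβ, hβ, hβ, update_self, update_self, update_self, Pi.add_apply, TensorProduct.add_tmul]
    · have hβ : ∀ c : MPacket1 D i, (fun β : {β : A // β ≠ α} => update m i c β.1) =
          update (fun β : {β : A // β ≠ α} => m β.1) ⟨i, h⟩ c :=
        fun c => update_comp_eq_of_injective' m Subtype.val_injective ⟨i, h⟩ c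
      rw [update_of_ne (Ne.symm h), update_of_ne (Ne.symm h), update_of_ne (Ne.symm h), hβ, hβ, hβ,
        MultilinearMap.map_update_add, TensorProduct.tmul_add]
  map_update_smul' m i c a := by
    by_cases h : i = α
    · subst h
      have hβ : ∀ c : MPacket1 D i,
          (fun β : {β : A // β ≠ i} => update m i c β.1) = fun β : {β : A // β ≠ i} => m β.1 :=
        fun c => funext fun β : {β : A // β ≠ i} => update_of_ne β.2 _ _
      rw [hβ, hβ, update_self, update_self, Pi.smul_apply, TensorProduct.smul_tmul']
    · have hβ : ∀ c : MPacket1 D i, (fun β : {β : A // β ≠ α} => update m i c β.1) =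
          update (fun β : {β : A // β ≠ α} => m β.1) ⟨i, h⟩ c :=
        fun c => update_comp_eq_of_injective' m Subtype.val_injective ⟨i, h⟩ c
      rw [update_of_ne (Ne.symm h), update_of_ne (Ne.symm h), hβ, hβ, MultilinearMap.map_update_smul,
        TensorProduct.tmul_smul]

/-- The retraction `log(^A𝒟^⊢_{v_ℚ}) →ₗ log(^{A,α}𝒟^⊢_v)`, `⊗_γ m_γ ↦ (m_α)_v ⊗ (⊗_{β≠α} m_β)` (the linear
map induced by `retrMultilinear`); a left inverse of `incl` (`retr_incl`). [claim: Mochizuki2012, status: disputed] -/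
def MPacketAt.retr (α : A) (v : Vfib) : MPacketN 𝕜 D →ₗ[𝕜] MPacketAt 𝕜 D α v :=
  PiTensorProduct.lift (MPacketAt.retrMultilinear 𝕜 D α v)

omit [DecidableEq A] [DecidableEq Vfib] in
/-- The retraction on pure tensors. [claim: Mochizuki2012, status: disputed] -/
@[simp] theorem MPacketAt.retr_tprod (α : A) (v : Vfib) (m : ∀ γ : A, MPacket1 D γ) :
    MPacketAt.retr 𝕜 D α v (tprod 𝕜 m) = m α v ⊗ₜ tprod 𝕜 (fun β : {β : A // β ≠ α} => m β.1) :=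
  PiTensorProduct.lift.tprod _

/-- `retr ∘ incl = id`: the retraction is a left inverse of the inclusion. [claim: Mochizuki2012, status: disputed] -/
theorem MPacketAt.retr_comp_incl (α : A) (v : Vfib) :
    MPacketAt.retr 𝕜 D α v ∘ₗ MPacketAt.incl 𝕜 D α v = LinearMap.id := by
  refine TensorProduct.ext' fun x w => ?_
  rw [LinearMap.comp_apply, LinearMap.id_apply]
  induction w using PiTensorProduct.induction_on with
  | smul_tprod r y =>
    rw [TensorProduct.tmul_smul, map_smul, map_smul, MPacketAt.incl_tmul_tprod, MPacketAt.retr_tprod]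
    congr 2
    · rw [MPacket1.insertAt_self, Pi.single_eq_same]
    · exact congrArg _ (funext fun β => MPacket1.insertAt_coe α _ y β)
  | add a b ha hb => rw [TensorProduct.tmul_add, map_add, map_add, ha, hb]

/-- `retr (incl t) = t`. [claim: Mochizuki2012, status: disputed] -/
@[simp] theorem MPacketAt.retr_incl (α : A) (v : Vfib) (t : MPacketAt 𝕜 D α v) :
    MPacketAt.retr 𝕜 D α v (MPacketAt.incl 𝕜 D α v t) = t := by
  rw [← LinearMap.comp_apply, MPacketAt.retr_comp_incl, LinearMap.id_apply]

/-- **[IUTchIII] Prop. 3.2, p. 98, "`⊆`"**: the canonical map `log(^{A,α}𝒟^⊢_v) → log(^A𝒟^⊢_{v_ℚ})` is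
INJECTIVE, so the abstractly typed `(A,α)`-packet is a submodule of the `n`-tensor packet.
[claim: Mochizuki2012, status: disputed] -/
theorem MPacketAt.incl_injective (α : A) (v : Vfib) :
    Function.Injective (MPacketAt.incl 𝕜 D α v) :=
  Function.LeftInverse.injective (MPacketAt.retr_incl 𝕜 D α v)

/-- **IUTchIII:Prop3.2(ii)**, nonarchimedean `v_ℚ` (p. 98): the third integral structure is carried into
the second by the inclusion, `𝓘(^{A,α}𝒟^⊢_v) ⊆ 𝓘(^A𝒟^⊢_{v_ℚ})` inside `log(^A𝒟^⊢_{v_ℚ})` — a generator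
`x ⊗ (⊗_β y_β)` (`x ∈ 𝓘_{^α𝒟^⊢_v}`, `y_β ∈ 𝓘(^β𝒟^⊢_{v_ℚ})`) maps to the pure tensor `⊗_γ m_γ` with
`m_α = (0,…,x,…,0) ∈ ⊕_w 𝓘_{^α𝒟^⊢_w}`, `m_β = y_β`. [claim: Mochizuki2012, status: disputed] -/
theorem MPacketAt.map_incl_shellPacketAt_le (I : ∀ α v, AddSubgroup (D α v)) (α : A) (v : Vfib) :
    (shellPacketAt 𝕜 D I α v).map (MPacketAt.incl 𝕜 D α v).toAddMonoidHom ≤ shellPacketN 𝕜 D I := by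
  rw [AddSubgroup.map_le_iff_le_comap, shellPacketAt, AddSubgroup.closure_le]
  rintro t ⟨x, y, hx, hy, rfl⟩
  rw [SetLike.mem_coe, AddSubgroup.mem_comap, LinearMap.toAddMonoidHom_coe, MPacketAt.incl_tmul_tprod]
  refine tprod_mem_shellPacketN D I _ fun γ w => ?_
  by_cases h : γ ≠ α
  · rw [MPacket1.insertAt_of_ne α _ y h]
    exact (mem_shellPacket1_iff D I γ (y ⟨γ, h⟩)).mp (hy ⟨γ, h⟩) w
  · obtain rfl : γ = α := not_not.mp h
    rw [MPacket1.insertAt_self]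
    by_cases hw : w = v
    · subst hw
      rwa [Pi.single_eq_same]
    · rw [Pi.single_eq_of_ne hw]
      exact AddSubgroup.zero_mem _

/-- The image of the third integral structure under the inclusion, elementwise.
[claim: Mochizuki2012, status: disputed] -/
theorem MPacketAt.incl_mem_shellPacketN (I : ∀ α v, AddSubgroup (D α v)) (α : A) (v : Vfib)
    {t : MPacketAt 𝕜 D α v} (ht : t ∈ shellPacketAt 𝕜 D I α v) :
    MPacketAt.incl 𝕜 D α v t ∈ shellPacketN 𝕜 D I :=
  MPacketAt.map_incl_shellPacketAt_le 𝕜 D I α v ⟨t, ht, rfl⟩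

variable {D} in
omit [DecidableEq Vfib] in
/-- Reassembling from the components of ONE family `x` is updating its `α`-component:
`insertAt α m (x|_{β≠α}) = update x α m`. [claim: Mochizuki2012, status: disputed] -/
theorem MPacket1.insertAt_eq_update (α : A) (m : MPacket1 D α) (x : ∀ γ : A, MPacket1 D γ) :
    MPacket1.insertAt α m (fun β : {β : A // β ≠ α} => x β.1) = update x α m := by
  funext γ
  by_cases h : γ ≠ α
  · rw [MPacket1.insertAt_of_ne α m _ h, update_of_ne h]
  · obtain rfl : γ = α := not_not.mp h
    rw [MPacket1.insertAt_self, update_self]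

omit [DecidableEq A] [DecidableEq Vfib] in
/-- The retraction kills every pure tensor whose `α`-factor has vanishing `v`-component.
[claim: Mochizuki2012, status: disputed] -/
theorem MPacketAt.retr_tprod_eq_zero (α : A) (v : Vfib) {m : ∀ γ : A, MPacket1 D γ} (hm : m α v = 0) :
    MPacketAt.retr 𝕜 D α v (tprod 𝕜 m) = 0 := by
  rw [MPacketAt.retr_tprod, hm, TensorProduct.zero_tmul]

/-- Splitting a generator of `𝓘(^A𝒟^⊢_{v_ℚ})` along the `v`-summand of its `α`-factor:
`⊗_γ m_γ = incl((m_α)_v ⊗ ⊗_{β≠α} m_β) + ⊗_γ m'_γ` with `m'_α = m_α − (0,…,(m_α)_v,…,0)` (so `(m'_α)_v = 0`) and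
`m'_β = m_β` — multilinearity of `⊗` in the `α`-slot. [claim: Mochizuki2012, status: disputed] -/
theorem MPacketAt.tprod_eq_incl_add (α : A) (v : Vfib) (m : ∀ γ : A, MPacket1 D γ) :
    tprod 𝕜 m =
      MPacketAt.incl 𝕜 D α v (m α v ⊗ₜ tprod 𝕜 fun β : {β : A // β ≠ α} => m β.1) +
        tprod 𝕜 (update m α (m α - Pi.single v (m α v))) := by
  rw [MPacketAt.incl_tmul_tprod, MPacket1.insertAt_eq_update, ← MultilinearMap.map_update_add,
    add_sub_cancel, update_eq_self]

/-- **IUTchIII:Prop3.2(ii)**, nonarchimedean `v_ℚ` (p. 98), converse inclusion and hence EQUALITY: the third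
integral structure is exactly the trace of the second on the sub-packet,
`𝓘(^{A,α}𝒟^⊢_v) = log(^{A,α}𝒟^⊢_v) ∩ 𝓘(^A𝒟^⊢_{v_ℚ})`, i.e. `incl⁻¹(𝓘(^A𝒟^⊢_{v_ℚ})) = 𝓘(^{A,α}𝒟^⊢_v)` — for
ARBITRARY additive subgroups `𝓘_{^γ𝒟^⊢_w}`.  Proof: every generator `⊗_γ m_γ` of `𝓘(^A𝒟^⊢_{v_ℚ})` splits
(`tprod_eq_incl_add`) into the image of a generator of `𝓘(^{A,α}𝒟^⊢_v)` plus a generator killed by the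
retraction `retr`; so for `incl t ∈ 𝓘(^A𝒟^⊢_{v_ℚ})`, applying `retr` (`retr ∘ incl = id`) exhibits `t` in
`𝓘(^{A,α}𝒟^⊢_v)`. [claim: Mochizuki2012, status: disputed] -/
theorem MPacketAt.comap_incl_shellPacketN (I : ∀ α v, AddSubgroup (D α v)) (α : A) (v : Vfib) :
    (shellPacketN 𝕜 D I).comap (MPacketAt.incl 𝕜 D α v).toAddMonoidHom = shellPacketAt 𝕜 D I α v := by
  refine le_antisymm ?_
    (AddSubgroup.map_le_iff_le_comap.mp (MPacketAt.map_incl_shellPacketAt_le 𝕜 D I α v))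
  -- `P` = image of the third structure, `Q` = generators with vanishing `v`-component in the `α`-factor
  set P : AddSubgroup (MPacketN 𝕜 D) :=
    (shellPacketAt 𝕜 D I α v).map (MPacketAt.incl 𝕜 D α v).toAddMonoidHom with hP
  set Q : AddSubgroup (MPacketN 𝕜 D) := AddSubgroup.closure
    {t | ∃ m : ∀ γ : A, MPacket1 D γ, (∀ γ w, m γ w ∈ I γ w) ∧ m α v = 0 ∧ t = tprod 𝕜 m} with hQ
  -- every generator of `𝓘(^A𝒟^⊢_{v_ℚ})` lies in `P ⊔ Q`
  have hle : shellPacketN 𝕜 D I ≤ P ⊔ Q := by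
    rw [shellPacketN, AddSubgroup.closure_le]
    rintro t ⟨m, hm, rfl⟩
    have hm' : ∀ γ w, m γ w ∈ I γ w := fun γ => (mem_shellPacket1_iff D I γ (m γ)).mp (hm γ)
    rw [SetLike.mem_coe, MPacketAt.tprod_eq_incl_add 𝕜 D α v m]
    refine AddSubgroup.add_mem_sup ?_ (AddSubgroup.subset_closure ⟨_, ?_, ?_, rfl⟩)
    · -- the `incl`-part is the image of a generator of `𝓘(^{A,α}𝒟^⊢_v)`
      have hgen : (m α v ⊗ₜ[𝕜] tprod 𝕜 fun β : {β : A // β ≠ α} => m β.1) ∈ shellPacketAt 𝕜 D I α v :=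
        AddSubgroup.subset_closure ⟨m α v, fun β => m β.1, hm' α v, fun β => hm β.1, rfl⟩
      exact AddSubgroup.mem_map_of_mem (MPacketAt.incl 𝕜 D α v).toAddMonoidHom hgen
    · intro γ w
      by_cases h : γ = α
      · subst h
        rw [update_self, Pi.sub_apply]
        by_cases hw : w = v
        · subst hw
          rw [Pi.single_eq_same, sub_self]
          exact AddSubgroup.zero_mem _
        · rw [Pi.single_eq_of_ne hw, sub_zero]
          exact hm' γ w
      · rw [update_of_ne h]
        exact hm' γ w
    · rw [update_self, Pi.sub_apply, Pi.single_eq_same, sub_self]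
  -- `Q` is killed by the retraction
  have hQ0 : ∀ q ∈ Q, MPacketAt.retr 𝕜 D α v q = 0 := by
    intro q hq
    refine AddSubgroup.closure_induction (fun t ht => ?_) (map_zero _) (fun a b _ _ ha hb => ?_)
      (fun a _ ha => ?_) hq
    · obtain ⟨m, -, hm0, rfl⟩ := ht
      exact MPacketAt.retr_tprod_eq_zero 𝕜 D α v hm0
    · rw [map_add, ha, hb, add_zero]
    · rw [map_neg, ha, neg_zero]
  -- conclusion: apply the retraction
  intro t ht
  rw [AddSubgroup.mem_comap, LinearMap.toAddMonoidHom_coe] at ht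
  obtain ⟨p, hp, q, hq, hpq⟩ := AddSubgroup.mem_sup.mp (hle ht)
  obtain ⟨s, hs, rfl⟩ := hp
  have key := congrArg (MPacketAt.retr 𝕜 D α v) hpq
  rw [map_add, hQ0 q hq, add_zero, LinearMap.toAddMonoidHom_coe, MPacketAt.retr_incl,
    MPacketAt.retr_incl] at key
  rw [← key]
  exact hs

/-- … elementwise: `incl t ∈ 𝓘(^A𝒟^⊢_{v_ℚ}) ↔ t ∈ 𝓘(^{A,α}𝒟^⊢_v)`. [claim: Mochizuki2012, status: disputed] -/
theorem MPacketAt.incl_mem_shellPacketN_iff (I : ∀ α v, AddSubgroup (D α v)) (α : A) (v : Vfib)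
    (t : MPacketAt 𝕜 D α v) :
    MPacketAt.incl 𝕜 D α v t ∈ shellPacketN 𝕜 D I ↔ t ∈ shellPacketAt 𝕜 D I α v := by
  rw [← MPacketAt.comap_incl_shellPacketN 𝕜 D I α v, AddSubgroup.mem_comap, LinearMap.toAddMonoidHom_coe]

end Inclusion

/-! ### Archimedean `v_ℚ`: the third Hermitian unit ball is the trace of the second -/

section Hermitian

open Literature.IUT.LogVolume Literature.IUT.LogVolume.Prop15iii

variable {A V : Type} [Fintype A] [DecidableEq A] [Fintype V] [DecidableEq V]

omit [Fintype A] [DecidableEq A] in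
/-- `⟪(0,…,z,…,0), (0,…,z',…,0)⟫_{⊕_w ℂ_w} = ⟪z, z'⟫_ℝ` (direct sum metric on vectors supported at one place).
[claim: Mochizuki2012, status: disputed] -/
theorem dsInner_single_single (v : V) (z z' : ℂ) :
    dsInner V (Pi.single v z) (Pi.single v z') = inner ℝ z z' := by
  rw [dsInner, Finset.sum_eq_single_of_mem v (Finset.mem_univ v)]
  · rw [Pi.single_eq_same, Pi.single_eq_same]
  · intro w _ hw
    rw [Pi.single_eq_of_ne hw, Pi.single_eq_of_ne hw, inner_zero_left]

omit [Fintype V] [DecidableEq V] in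
/-- `∏_{γ∈A} f γ = f α · ∏_{β≠α} f β`. [folklore] -/
private theorem prod_eq_mul_prod_subtype_ne {M : Type*} [CommMonoid M] (f : A → M) (α : A) :
    ∏ γ, f γ = f α * ∏ β : {β : A // β ≠ α}, f β.1 := by
  rw [← Finset.mul_prod_erase Finset.univ f (Finset.mem_univ α),
    Finset.prod_subtype (Finset.univ.erase α) (p := fun β => β ≠ α)]
  intro x
  simp [Finset.mem_erase]

/-- The tensor product metric of `log(^A𝒟^⊢_{v_ℚ})` on the images of elementary tensors of
`log(^{A,α}𝒟^⊢_v)`: `B₀(incl (z ⊗ ⊗y), incl (z' ⊗ ⊗y')) = B₀^{β≠α}(⊗y, ⊗y')·⟪z,z'⟫_ℝ` — the value of the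
`(A,α)`-metric `atForm` (`atForm_tmul`). [claim: Mochizuki2012, status: disputed] -/
theorem tensorForm_incl_tmul_tprod (α : A) (v : V) (z z' : ℂ)
    (y y' : ∀ β : {β : A // β ≠ α}, MPacket1 (ArchComponents A V) β.1) :
    tensorForm A V (MPacketAt.incl ℝ (ArchComponents A V) α v (z ⊗ₜ tprod ℝ y))
        (MPacketAt.incl ℝ (ArchComponents A V) α v (z' ⊗ₜ tprod ℝ y')) =
      tensorForm {β : A // β ≠ α} V (tprod ℝ y) (tprod ℝ y') * inner ℝ z z' := by
  rw [MPacketAt.incl_tmul_tprod, MPacketAt.incl_tmul_tprod]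
  erw [isTensorMetric_tensorForm A V, isTensorMetric_tensorForm {β : A // β ≠ α} V]
  rw [prod_eq_mul_prod_subtype_ne _ α, MPacket1.insertAt_self, MPacket1.insertAt_self,
    dsInner_single_single, mul_comm]
  congr 1
  exact Finset.prod_congr rfl fun β _ => by rw [MPacket1.insertAt_coe, MPacket1.insertAt_coe]

/-- **IUTchIII:Prop3.2(ii)**, archimedean `v_ℚ` (p. 99): the tensor product Hermitian metric of
`log(^{A,α}𝒟^⊢_v)` (`atForm`, `TensorPacketsHermitian.lean`) IS the restriction along
`log(^{A,α}𝒟^⊢_v) ⊆ log(^A𝒟^⊢_{v_ℚ})` of "the induced tensor product Hermitian metric on `log(^A𝒟^⊢_{v_ℚ})`"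
(`tensorForm`) — the summands `ℂ_w` of `⊕_w ℂ_w` being mutually orthogonal for the direct sum metric.
[claim: Mochizuki2012, status: disputed] -/
theorem atForm_eq_tensorForm_incl (α : A) (v : V) (t t' : MPacketAt ℝ (ArchComponents A V) α v) :
    atForm A V α v t t' =
      tensorForm A V (MPacketAt.incl ℝ (ArchComponents A V) α v t)
        (MPacketAt.incl ℝ (ArchComponents A V) α v t') := by
  suffices h : atForm A V α v =
      (tensorForm A V).compl₁₂ (MPacketAt.incl ℝ (ArchComponents A V) α v)
        (MPacketAt.incl ℝ (ArchComponents A V) α v) by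
    rw [h, LinearMap.compl₁₂_apply]
  refine TensorProduct.ext' fun z w => ?_
  refine TensorProduct.ext' fun z' w' => ?_
  rw [LinearMap.compl₁₂_apply]
  induction w using PiTensorProduct.induction_on with
  | smul_tprod r y =>
    induction w' using PiTensorProduct.induction_on with
    | smul_tprod r' y' =>
      simp only [TensorProduct.tmul_smul, map_smul, LinearMap.smul_apply, smul_eq_mul, atForm_tmul,
        tensorForm_incl_tmul_tprod]
    | add a b ha hb => simp only [TensorProduct.tmul_add, map_add, ha, hb]
  | add a b ha hb => simp only [TensorProduct.tmul_add, map_add, LinearMap.add_apply, ha, hb]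

/-- **IUTchIII:Prop3.2(ii)**, archimedean `v_ℚ` (p. 99): the closed unit ball `𝓘(^{A,α}𝒟^⊢_v)` of the
Hermitian metric on `log(^{A,α}𝒟^⊢_v)` is EXACTLY the trace on `log(^{A,α}𝒟^⊢_v) ⊆ log(^A𝒟^⊢_{v_ℚ})` of the
closed unit ball `𝓘(^A𝒟^⊢_{v_ℚ})`: `hermitianBallAt = incl⁻¹(hermitianBallN)`. [claim: Mochizuki2012, status: disputed] -/
theorem hermitianBallAt_eq_preimage_hermitianBallN (r : ℝ) (α : A) (v : V) :
    hermitianBallAt A V r α v = MPacketAt.incl ℝ (ArchComponents A V) α v ⁻¹' hermitianBallN A V r := by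
  ext t
  rw [mem_hermitianBallAt_iff, Set.mem_preimage, mem_hermitianBallN_iff, atForm_eq_tensorForm_incl]

/-- … hence `incl(𝓘(^{A,α}𝒟^⊢_v)) = 𝓘(^A𝒟^⊢_{v_ℚ}) ∩ log(^{A,α}𝒟^⊢_v)` (as subsets of `log(^A𝒟^⊢_{v_ℚ})`).
[claim: Mochizuki2012, status: disputed] -/
theorem image_incl_hermitianBallAt (r : ℝ) (α : A) (v : V) :
    MPacketAt.incl ℝ (ArchComponents A V) α v '' hermitianBallAt A V r α v =
      hermitianBallN A V r ∩ Set.range (MPacketAt.incl ℝ (ArchComponents A V) α v) := by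
  rw [hermitianBallAt_eq_preimage_hermitianBallN, Set.image_preimage_eq_inter_range]

/-- … in particular `incl(𝓘(^{A,α}𝒟^⊢_v)) ⊆ 𝓘(^A𝒟^⊢_{v_ℚ})` (the archimedean analogue of
`map_incl_shellPacketAt_le`). [claim: Mochizuki2012, status: disputed] -/
theorem mapsTo_incl_hermitianBallAt (r : ℝ) (α : A) (v : V) :
    Set.MapsTo (MPacketAt.incl ℝ (ArchComponents A V) α v) (hermitianBallAt A V r α v)
      (hermitianBallN A V r) := by
  rw [hermitianBallAt_eq_preimage_hermitianBallN]
  exact Set.mapsTo_preimage _ _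

/-- The genuine inhabitant `ArchimedeanShellData.hermitian` (p412100) thus satisfies the compatibility the
interface does not record: its `ballAt α v` is the trace of its `ballN` along the inclusion.
[claim: Mochizuki2012, status: disputed] -/
theorem ArchimedeanShellData.hermitian_ballAt_eq {r : ℝ} (hr : 0 ≤ r) (α : A) (v : V) :
    (ArchimedeanShellData.hermitian A V hr).ballAt α v =
      MPacketAt.incl ℝ (ArchComponents A V) α v ⁻¹' (ArchimedeanShellData.hermitian A V hr).ballN :=
  hermitianBallAt_eq_preimage_hermitianBallN r α v

end Hermitian

end Literature.IUT.LogThetaLattice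

end
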